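import Mathlib.MeasureTheory.Measure.GiryMonad
import Mathlib.MeasureTheory.Integral.Lebesgue.Countable
import HarnessLib

/-!
# Antitone versions of almost-surely antitone families of random measures

Topic `Literature/Probability/Distributions`; measure-theoretic bookkeeping ("VERSIONS") for
families of measurable kernels indexed by a real cutoff, written for the admissibility clauses of
the Garban–Pete–Schramm pivotal kernels of lattice models (route
`Summits/CriticalPhenomena/CardyFormulaZ2/Theses/CardyMeckeFlip`, crux `FlipErgodicityZ2`, stub
"the pivotal kernel of a bond-`ℤ²` sublimit exists and is admissible": the limit pins each cutoff
kernel `M ε : X → Measure ℂ` only almost surely, while clause (ADM)(2) — antitone in the cutoff —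
is required POINTWISE in the configuration and for ALL real cutoffs), but model-free.

**Results.**
* `iSup_measure_apply_of_directed` — the supremum (in Mathlib's complete lattice `Measure α`) of
  a COUNTABLE DIRECTED family of measures is computed setwise, `(⨆ i, ν i) s = ⨆ i, ν i s`, for
  every set `s` (for measurable `s` the setwise supremum is countably additive — monotone
  convergence for series — hence a measure, which is then the least upper bound; general `s` via
  a common measurable hull);
* `exists_antitone_version` — **the version lemma**: from measurable kernels `N d : X → Measure α`
  indexed by a countable set `D ⊆ ℝ` of cutoffs, antitone along `D` on a measurable conull set
  `X₀`, build `M : ℝ → X → Measure α` with every `M ε` measurable, `ε ↦ M ε S` antitone on ALL of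
  `ℝ` for EVERY `S`, `M d S = N d S` for `d ∈ D`, `S ∈ X₀` (hence almost surely), `M ε S = 0` off
  `X₀`, and the explicit formula `M ε S s = ⨆_{d ∈ D, d ≥ ε} N d S s` on `X₀`
  (so that null sets common to the `N d S`, `d ≥ ε`, stay null).  Construction:
  `M ε S := ⨆_{d ∈ D, ε ≤ d} N' d S` with `N' d := 1_{X₀} N d`.

No named fact; Mathlib only.

## References

* O. Kallenberg, *Random Measures, Theory and Applications* (2017), §1.2 and Lemma 1.14
  (kernels, measurability through a countable determining class; regularisation of versions).
-/

noncomputable section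

open Set Filter
open _root_.MeasureTheory _root_.Topology
open scoped ENNReal

namespace Literature.Probability.Distributions

/-! ### Directed suprema of measures are computed setwise -/

section DirectedSup

variable {α ι : Type*} [MeasurableSpace α] [Countable ι] {ν : ι → Measure α}

/-- For a directed family, `∑' n, ⨆ i, g i n = ⨆ i, ∑' n, g i n` in `ℝ≥0∞` (monotone convergence
for the counting measure). [folklore] -/
theorem tsum_iSup_of_directed {g : ι → ℕ → ℝ≥0∞} (hg : Directed (· ≤ ·) g) :
    ∑' n, ⨆ i, g i n = ⨆ i, ∑' n, g i n := by
  rw [← lintegral_count]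
  simp_rw [← lintegral_count]
  exact lintegral_iSup_directed_of_measurable (fun i => measurable_of_countable _) hg

/-- **The supremum of a countable directed family of measures is computed setwise on measurable
sets.** [folklore] -/
theorem iSup_measure_apply_of_directed_of_measurableSet (hν : Directed (· ≤ ·) ν) {s : Set α}
    (hs : MeasurableSet s) : (⨆ i, ν i) s = ⨆ i, ν i s := by
  -- the setwise supremum is a measure …
  set ρ : Measure α := Measure.ofMeasurable (fun s _ => ⨆ i, ν i s) (by simp)
    (fun f hf hdisj => by
      show ⨆ i, ν i (⋃ n, f n) = ∑' n, ⨆ i, ν i (f n)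
      simp_rw [measure_iUnion hdisj hf]
      rw [tsum_iSup_of_directed]
      intro i j
      obtain ⟨k, hik, hjk⟩ := hν i j
      exact ⟨k, fun n => Measure.le_iff'.1 hik _, fun n => Measure.le_iff'.1 hjk _⟩) with hρ
  have hρs : ∀ t : Set α, MeasurableSet t → ρ t = ⨆ i, ν i t := fun t ht => by
    rw [hρ, Measure.ofMeasurable_apply t ht]
  -- … and it is the least upper bound
  have hsup : (⨆ i, ν i) = ρ := by
    refine le_antisymm (iSup_le fun i => Measure.le_iff.2 fun t ht => ?_)
      (Measure.le_iff.2 fun t ht => ?_)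
    · rw [hρs t ht]
      exact le_iSup (fun i => ν i t) i
    · rw [hρs t ht]
      exact iSup_le fun i => Measure.le_iff.1 (le_iSup ν i) t ht
  rw [hsup, hρs s hs]

/-- **The supremum of a countable directed family of measures is computed setwise**, on every
set (pass to a common measurable hull of `s` for the countably many measures). [folklore] -/
theorem iSup_measure_apply_of_directed (hν : Directed (· ≤ ·) ν) (s : Set α) :
    (⨆ i, ν i) s = ⨆ i, ν i s := by
  refine le_antisymm ?_ (iSup_le fun i => Measure.le_iff'.1 (le_iSup ν i) s)
  obtain ⟨t, hst, ht, hνt⟩ := exists_measurable_superset_forall_eq ν s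
  calc (⨆ i, ν i) s ≤ (⨆ i, ν i) t := measure_mono hst
    _ = ⨆ i, ν i t := iSup_measure_apply_of_directed_of_measurableSet hν ht
    _ = ⨆ i, ν i s := by simp only [hνt]

/-- A countable directed supremum of measurable kernels is a measurable kernel. [folklore] -/
theorem measurable_iSup_of_directed {X : Type*} [MeasurableSpace X] {κ : ι → X → Measure α}
    (hκ : ∀ i, Measurable (κ i)) (hdir : ∀ S, Directed (· ≤ ·) fun i => κ i S) :
    Measurable fun S => ⨆ i, κ i S := by
  refine Measure.measurable_of_measurable_coe _ fun s hs => ?_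
  simp_rw [iSup_measure_apply_of_directed (hdir _) s]
  exact Measurable.iSup fun i => (Measure.measurable_coe hs).comp (hκ i)

end DirectedSup

/-! ### The version lemma -/

section Version

variable {X α : Type*} [MeasurableSpace X] [MeasurableSpace α]

/-- **Antitone versions of almost-surely antitone families of kernels.**  Let `D ⊆ ℝ` be a
countable set of cutoffs, `N d : X → Measure α` (`d ∈ D`) measurable kernels, and `X₀ ⊆ X` a
measurable set on which the family is antitone along `D` (`N d' S ≤ N d S` for `d ≤ d'` in `D`,
`S ∈ X₀`).  Then there is `M : ℝ → X → Measure α` with: every `M ε` measurable; `ε ↦ M ε S`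
antitone on all of `ℝ`, for every `S`; `M d S = N d S` for `d ∈ D` and `S ∈ X₀`; `M ε S = 0`
off `X₀`; and on `X₀` the explicit formula `M ε S s = ⨆_{d ∈ D, ε ≤ d} N d S s` for every set
`s`.  (Take `M ε S := ⨆_{d ∈ D, ε ≤ d} 1_{X₀}(S) N d S`, a directed supremum.)  If `X₀` is
conull for a law `μ` on `X`, `M d = N d` `μ`-almost surely for every `d ∈ D`
(`exists_antitone_version_ae`). [folklore] -/
theorem exists_antitone_version {D : Set ℝ} (hD : D.Countable) (N : ℝ → X → Measure α)
    (hN : ∀ d ∈ D, Measurable (N d)) {X₀ : Set X} (hX₀ : MeasurableSet X₀)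
    (hanti : ∀ S ∈ X₀, ∀ d ∈ D, ∀ d' ∈ D, d ≤ d' → N d' S ≤ N d S) :
    ∃ M : ℝ → X → Measure α,
      (∀ ε, Measurable (M ε)) ∧
        (∀ ε ε' : ℝ, ε' ≤ ε → ∀ S, M ε S ≤ M ε' S) ∧
          (∀ d ∈ D, ∀ S ∈ X₀, M d S = N d S) ∧
            (∀ S, S ∉ X₀ → ∀ ε, M ε S = 0) ∧
              ∀ S ∈ X₀, ∀ (ε : ℝ) (s : Set α),
                M ε S s = ⨆ d : {d : ℝ // d ∈ D ∧ ε ≤ d}, N d S s := by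
  classical
  -- the truncated kernels, antitone along `D` everywhere
  set N' : ℝ → X → Measure α := fun d S => if S ∈ X₀ then N d S else 0 with hN'
  have hN'm : ∀ d ∈ D, Measurable (N' d) := fun d hd =>
    Measurable.ite hX₀ (hN d hd) measurable_const
  have hN'anti : ∀ S, ∀ d ∈ D, ∀ d' ∈ D, d ≤ d' → N' d' S ≤ N' d S := by
    intro S d hd d' hd' hdd'
    by_cases hS : S ∈ X₀
    · simp only [hN', hS, if_true]
      exact hanti S hS d hd d' hd' hdd'
    · simp only [hN', hS, if_false, le_refl]
  have hN'X₀ : ∀ S ∈ X₀, ∀ d, N' d S = N d S := fun S hS d => if_pos hS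
  have hN'off : ∀ S, S ∉ X₀ → ∀ d, N' d S = 0 := fun S hS d => if_neg hS
  -- the index types and directedness
  haveI hcount : ∀ ε : ℝ, Countable {d : ℝ // d ∈ D ∧ ε ≤ d} := fun ε =>
    (hD.mono fun d (hd : d ∈ D ∧ ε ≤ d) => hd.1).to_subtype
  have hdir : ∀ (ε : ℝ) (S : X),
      Directed (· ≤ ·) fun d : {d : ℝ // d ∈ D ∧ ε ≤ d} => N' d S := by
    intro ε S d₁ d₂
    have hmin : min d₁.1 d₂.1 ∈ D := by
      rcases min_choice d₁.1 d₂.1 with h | h <;> rw [h]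
      exacts [d₁.2.1, d₂.2.1]
    exact ⟨⟨min d₁.1 d₂.1, hmin, le_min d₁.2.2 d₂.2.2⟩,
      hN'anti S _ hmin _ d₁.2.1 (min_le_left _ _), hN'anti S _ hmin _ d₂.2.1 (min_le_right _ _)⟩
  -- the version
  set M : ℝ → X → Measure α := fun ε S => ⨆ d : {d : ℝ // d ∈ D ∧ ε ≤ d}, N' d S with hM
  refine ⟨M, fun ε => ?_, fun ε ε' hε S => ?_, fun d hd S hS => ?_, fun S hS ε => ?_,
    fun S hS ε s => ?_⟩
  · -- measurable
    exact measurable_iSup_of_directed (fun d => hN'm d.1 d.2.1) (hdir ε)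
  · -- antitone in the cutoff, everywhere
    exact iSup_le fun d => le_iSup_of_le (f := fun d : {d : ℝ // d ∈ D ∧ ε' ≤ d} => N' d S)
      ⟨d.1, d.2.1, hε.trans d.2.2⟩ le_rfl
  · -- agrees with `N d` on `X₀` for `d ∈ D`
    refine le_antisymm (iSup_le fun d' => ?_) ?_
    · rw [← hN'X₀ S hS d]
      exact hN'anti S d hd d'.1 d'.2.1 d'.2.2
    · rw [← hN'X₀ S hS d]
      exact le_iSup (fun d' : {d' : ℝ // d' ∈ D ∧ d ≤ d'} => N' d' S) ⟨d, hd, le_rfl⟩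
  · -- vanishes off `X₀`
    refine le_antisymm (iSup_le fun d => ?_) (Measure.zero_le _)
    rw [hN'off S hS]
  · -- the setwise formula on `X₀`
    show (⨆ d : {d : ℝ // d ∈ D ∧ ε ≤ d}, N' d S) s = ⨆ d : {d : ℝ // d ∈ D ∧ ε ≤ d}, N d S s
    rw [iSup_measure_apply_of_directed (hdir ε S) s]
    simp only [hN'X₀ S hS]

/-- The version lemma with a law: if `X₀` is `μ`-conull, the version agrees with the given kernels
almost surely at every cutoff of `D`. [folklore] -/
theorem exists_antitone_version_ae (μ : Measure X) {D : Set ℝ} (hD : D.Countable)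
    (N : ℝ → X → Measure α) (hN : ∀ d ∈ D, Measurable (N d)) {X₀ : Set X}
    (hX₀ : MeasurableSet X₀) (hμ : ∀ᵐ S ∂μ, S ∈ X₀)
    (hanti : ∀ S ∈ X₀, ∀ d ∈ D, ∀ d' ∈ D, d ≤ d' → N d' S ≤ N d S) :
    ∃ M : ℝ → X → Measure α,
      (∀ ε, Measurable (M ε)) ∧
        (∀ ε ε' : ℝ, ε' ≤ ε → ∀ S, M ε S ≤ M ε' S) ∧
          (∀ d ∈ D, ∀ᵐ S ∂μ, M d S = N d S) ∧
            (∀ S, S ∉ X₀ → ∀ ε, M ε S = 0) ∧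
              ∀ S ∈ X₀, ∀ (ε : ℝ) (s : Set α),
                M ε S s = ⨆ d : {d : ℝ // d ∈ D ∧ ε ≤ d}, N d S s := by
  obtain ⟨M, hm, ha, heq, hoff, hsup⟩ := exists_antitone_version hD N hN hX₀ hanti
  exact ⟨M, hm, ha, fun d hd => hμ.mono fun S hS => heq d hd S hS, hoff, hsup⟩

omit [MeasurableSpace X] in
/-- Null sets common to the kernels above a cutoff stay null for the version (from the setwise
formula): if `N d S s = 0` for all `d ∈ D` with `ε ≤ d`, then `⨆_{d ∈ D, ε ≤ d} N d S s = 0`.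
[folklore] -/
theorem iSup_subtype_apply_eq_zero {D : Set ℝ} (N : ℝ → X → Measure α) (S : X) (ε : ℝ)
    (s : Set α) (h : ∀ d ∈ D, ε ≤ d → N d S s = 0) :
    (⨆ d : {d : ℝ // d ∈ D ∧ ε ≤ d}, N d S s) = 0 :=
  le_antisymm (iSup_le fun d => (h d.1 d.2.1 d.2.2).le) bot_le

end Version

end Literature.Probability.Distributions

end
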